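import Summits.NavierStokesRegularity.FluidComputer.GateBudgetDose
import HarnessLib

/-!
# What no tuning can beat, part 7: the QUARTER-TURN law while the clock lives, and the dose law
# in Tao's CERTIFIED regime (Theorem 5.3 for the retuned family) — hypotheses discharged

Cell `pub-fluidc`, blueprint seat bp1 (gen 23, block 2); same namespace and conventions as parts
1–6; this part imports part 6 (hence part 1 and the Literature proof of Theorem 5.3 for the family,
`RetunedTransition`). HONEST FRAMING (verbatim): low prior, high value-of-information experiment on
Tao's machine paradigm; NOT a claim that NS blows up. Five-mode quadratic ODEs on `ℝ⁵`
(`fiveGateCircuit ε σ μ R K`; Tao's retuned family `delayCircuitWith K M ε` is the slice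
`σ = ε²e^{-M}, μ = ε⁻¹M, R = ε⁻²`) started EXACTLY at (5.6) `delayInit`; nothing is proved about
the Navier–Stokes equations.

## The laws

Part 6 (`dose_law`): on a window `[t₀,T]` where the trigger is alive (`c > 0`) and the trigger pair
is armed (`b² + c² ≥ ϱ²`), every primitive `C` of `c` obeys
`(μ - ε/ϱ²)(C(T) - C(t₀)) ≤ arctan(b/c)(t₀) - arctan(b/c)(T) + σ(T-t₀)/ϱ < π + σ(T-t₀)/ϱ`.

(i) QUARTER-TURN LAW (`dose_le_quarter_turn`, `taoFamily_dose_le_quarter_turn`). If at the END of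
the window the clock is still un-reversed (`b(T) ≥ 0`), the pair `(b,c)` is still in the closed
first quadrant, `arctan(b/c)(T) ≥ 0`, and the bound improves to a QUARTER turn:
`(μ - ε/ϱ²)(C(T) - C(t₀)) < π/2 + σ(T-t₀)/ϱ`; for Tao's family (`ϱ = κε`)
`(M - κ⁻²)(C(T) - C(t₀)) < επ/2 + ε²e^{-M}(T-t₀)/κ`.

(ii) THE CERTIFIED REGIME (`c_floor_after`, `dose_after_tc`, `certified_dose`,
`certified_dose_small`). In the regime of Theorem 5.3 for the family — `K ≥ K₀ = 2·20⁴²·42! + 16`,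
`3000 log K ≤ M ≤ K¹⁰`, `0 < ε ≤ e^{-10M}/K¹⁰⁰` — the Literature bootstrap gives, after the
critical time `t_c` (`|t_c - √2| ≤ 24 log K/M`, `c(t_c) = ε²/K¹⁰`), the clock floor `b ≥ ε/8` on
`[t_c,2]` (`Thm53With.b_lower_after`); hence `c` is non-decreasing there, `c ≥ ε²/K¹⁰ > 0`
(`c_floor_after`), the pair is armed with `ϱ = ε/8` and un-reversed, and the hypotheses of the
dose law are DISCHARGED: on every sub-window `[t₀,T] ⊆ [t_c,2]`, for every primitive `C` of `c`,

  `(M - 64)(C(T) - C(t₀)) < επ/2 + 8ε²e^{-M}(T-t₀)`   and   `C(T) - C(t₀) < 2ε/M`.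

READING. Throughout Tao's window `[0,2]` the trigger rotor stays in the first quadrant: less than a
quarter of the half-turn budget of part 6 is spent by `t = 2`, although `c` has grown from
`ε²/K¹⁰` to `≥ K¹⁰⁰ε²` and fired the rotor; the trigger's whole dose on `[t_c,2]` is `< 2ε/M`. The
rest of the half turn — the reversal of the clock and the afterglow of part 5 — lies beyond `t = 2`,
outside Theorem 5.3.

HONEST LIMITS. (i) holds for every signs-admissible member under the stated window hypotheses;
(ii) only in the certified regime above, on `[t_c,2]`; no statement about `t > 2`; `0` named facts;
`0` sorry. [cite: Tao2016AveragedNS, §5.5 Theorem 5.3, (5.5), (5.6), (bogo-2), (c-large)].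
-/

noncomputable section

namespace Summit.NavierStokesRegularity.FluidComputer.GateBudget

open Real Set Filter Topology
open Literature.Analysis.FluidPDE.Tao2016AveragedNS
open Literature.Analysis.FluidPDE.Tao2016AveragedNS.Thm53 (antitoneOn_sub_of_deriv_le
  monotoneOn_sub_of_le_deriv)

variable {ε σ μ R K : ℝ} {X : ℝ → Fin 5 → ℝ}

/-! ## §17 The quarter-turn law: an un-reversed clock has spent less than a quarter turn -/

/-- `arctan` of a quotient with non-negative numerator and positive denominator is `≥ 0`.
[folklore] -/
theorem arctan_div_nonneg {b c : ℝ} (hb : 0 ≤ b) (hc : 0 < c) : 0 ≤ arctan (b / c) := by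
  have h := Real.arctan_strictMono.monotone (div_nonneg hb hc.le)
  rwa [Real.arctan_zero] at h

/-- **THE QUARTER-TURN LAW.** On a window `[t₀,T]` with `c > 0`, `b² + c² ≥ ϱ² > 0` and the clock
still un-reversed at the end (`b(T) ≥ 0`), every primitive `C` of `c` obeys
`(μ - ε/ϱ²)(C(T) - C(t₀)) < π/2 + σ(T-t₀)/ϱ`. [cite: Tao2016AveragedNS, §5.5 (5.5)] -/
theorem dose_le_quarter_turn (hX : ∀ t, HasDerivAt X (fiveGateCircuit ε σ μ R K (X t)) t)
    (h0 : X 0 = delayInit) (hε : 0 ≤ ε) (hσ : 0 ≤ σ) {t₀ T ϱ : ℝ} (ht : t₀ ≤ T) (hϱ : 0 < ϱ)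
    (hc : ∀ t ∈ Icc t₀ T, 0 < X t 2) (hr : ∀ t ∈ Icc t₀ T, ϱ ^ 2 ≤ X t 1 ^ 2 + X t 2 ^ 2)
    (hbT : 0 ≤ X T 1) {C : ℝ → ℝ} (hC : ∀ t ∈ Icc t₀ T, HasDerivAt C (X t 2) t) :
    (μ - ε / ϱ ^ 2) * (C T - C t₀) < π / 2 + σ * (T - t₀) / ϱ := by
  have h := dose_law hX h0 hε hσ ht hϱ hc hr hC
  have h1 := arctan_lt_pi_div_two (X t₀ 1 / X t₀ 2)
  have h2 := arctan_div_nonneg hbT (hc T (right_mem_Icc.mpr ht))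
  linarith

/-- **TAO-FAMILY QUARTER-TURN.** Same window for `delayCircuitWith K M ε` with `ϱ = κε`:
`(M - κ⁻²)(C(T) - C(t₀)) < επ/2 + ε²e^{-M}(T-t₀)/κ`.
[cite: Tao2016AveragedNS, §5.5 Theorem 5.3, (5.5)] -/
theorem taoFamily_dose_le_quarter_turn {K M ε : ℝ} {X : ℝ → Fin 5 → ℝ}
    (hX : ∀ t, HasDerivAt X (delayCircuitWith K M ε (X t)) t) (h0 : X 0 = delayInit)
    (hε : 0 < ε) {t₀ T κ : ℝ} (ht : t₀ ≤ T) (hκ : 0 < κ)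
    (hc : ∀ t ∈ Icc t₀ T, 0 < X t 2) (hr : ∀ t ∈ Icc t₀ T, (κ * ε) ^ 2 ≤ X t 1 ^ 2 + X t 2 ^ 2)
    (hbT : 0 ≤ X T 1) {C : ℝ → ℝ} (hC : ∀ t ∈ Icc t₀ T, HasDerivAt C (X t 2) t) :
    (M - (κ ^ 2)⁻¹) * (C T - C t₀) < ε * π / 2 + ε ^ 2 * exp (-M) * (T - t₀) / κ := by
  have h := taoFamily_dose hX h0 hε ht hκ hc hr hC
  have h1 := arctan_lt_pi_div_two (X t₀ 1 / X t₀ 2)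
  have h2 := arctan_div_nonneg hbT (hc T (right_mem_Icc.mpr ht))
  have h3 : ε * (arctan (X t₀ 1 / X t₀ 2) - arctan (X T 1 / X T 2)) < ε * (π / 2) :=
    mul_lt_mul_of_pos_left (by linarith) hε
  linarith

/-! ## §18 Tao's certified regime: the hypotheses of the dose law discharged on `[t_c, 2]` -/

section Certified

variable {K M ε τ : ℝ} {X : ℝ → Fin 5 → ℝ}

/-- **Trigger floor after the critical time.** Under the bootstrap hypotheses of
`Thm53With.b_lower_after` and `c(τ) = ε²/K¹⁰`: the clock floor `b ≥ ε/8 > 0` makes `c`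
non-decreasing on `[τ,2]`, so `c ≥ ε²/K¹⁰` there.
[cite: Tao2016AveragedNS, §5.5 proof of Theorem 5.3, (bogo-2)] -/
theorem c_floor_after (hX : ∀ t, HasDerivAt X (delayCircuitWith K M ε (X t)) t)
    (h0 : X 0 = delayInit) (hε : 0 < ε) (hε1 : ε ≤ 1) (hM0 : 0 < M) (hMK : M ≤ K ^ 10)
    (hK : 16 ≤ K) (hεK : ε ^ 2 ≤ 1 / (6 * K ^ 20)) (hεexp : ε ^ 2 ≤ exp (-(18 * M)) / (64 * M))
    (hτ1 : 1 ≤ τ) (hτ2 : τ ≤ 2) (hcτ : ∀ t, 0 ≤ t → t ≤ τ → X t 2 ≤ ε ^ 2 / K ^ 10)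
    (hcτeq : X τ 2 = ε ^ 2 / K ^ 10) {t : ℝ} (ht : t ∈ Icc τ 2) :
    ε ^ 2 / K ^ 10 ≤ X t 2 := by
  have hmono := monotoneOn_sub_of_le_deriv (s := Icc τ 2) (φ := fun _ => 0) (Φ := fun _ => 0)
    (convex_Icc τ 2) (fun s _ => Thm53With.hasDerivAt_c hX s)
    (fun s _ => hasDerivAt_const s (0 : ℝ))
    (fun s hs => by
      have hb : ε / 8 ≤ X s 1 :=
        Thm53With.b_lower_after hX h0 hε hε1 hM0 hMK hK hεK hεexp hτ1 hτ2 hcτ hs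
      have hb0 : 0 ≤ X s 1 := by linarith
      have hc0 : 0 ≤ X s 2 := Thm53With.c_nonneg hX h0 (by linarith [hs.1])
      have hM' : 0 ≤ ε⁻¹ * M := by positivity
      have h1 : 0 ≤ ε ^ 2 * exp (-M) * X s 0 ^ 2 := by positivity
      have h2 : 0 ≤ ε⁻¹ * M * X s 1 * X s 2 := mul_nonneg (mul_nonneg hM' hb0) hc0
      show (0 : ℝ) ≤ ε ^ 2 * exp (-M) * X s 0 ^ 2 + ε⁻¹ * M * X s 1 * X s 2
      linarith)
  have h := hmono (left_mem_Icc.mpr hτ2) ht ht.1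
  simp only [sub_zero] at h
  linarith

/-- **THE DOSE LAW AFTER THE CRITICAL TIME** (technical form, `τ = t_c` explicit). Under the same
bootstrap hypotheses, on every sub-window `[t₀,T] ⊆ [τ,2]`, every primitive `C` of `c` obeys
`(M - 64)(C(T) - C(t₀)) < επ/2 + 8ε²e^{-M}(T-t₀)`: part 6 with `ϱ = ε/8` (armed by the clock
floor), `c > 0` by `c_floor_after`, un-reversed clock by the floor again.
[cite: Tao2016AveragedNS, §5.5 Theorem 5.3, (5.5), (bogo-2)] -/
theorem dose_after_tc (hX : ∀ t, HasDerivAt X (delayCircuitWith K M ε (X t)) t)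
    (h0 : X 0 = delayInit) (hε : 0 < ε) (hε1 : ε ≤ 1) (hM0 : 0 < M) (hMK : M ≤ K ^ 10)
    (hK : 16 ≤ K) (hεK : ε ^ 2 ≤ 1 / (6 * K ^ 20)) (hεexp : ε ^ 2 ≤ exp (-(18 * M)) / (64 * M))
    (hτ1 : 1 ≤ τ) (hτ2 : τ ≤ 2) (hcτ : ∀ t, 0 ≤ t → t ≤ τ → X t 2 ≤ ε ^ 2 / K ^ 10)
    (hcτeq : X τ 2 = ε ^ 2 / K ^ 10) {t₀ T : ℝ} (h₀ : τ ≤ t₀) (ht : t₀ ≤ T) (hT : T ≤ 2)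
    {C : ℝ → ℝ} (hC : ∀ t ∈ Icc t₀ T, HasDerivAt C (X t 2) t) :
    (M - 64) * (C T - C t₀) < ε * π / 2 + 8 * ε ^ 2 * exp (-M) * (T - t₀) := by
  have hK0 : 0 < K := by linarith
  have hsub : ∀ t ∈ Icc t₀ T, t ∈ Icc τ 2 := fun t ht' => ⟨le_trans h₀ ht'.1, le_trans ht'.2 hT⟩
  have hb : ∀ t ∈ Icc t₀ T, ε / 8 ≤ X t 1 := fun t ht' =>
    Thm53With.b_lower_after hX h0 hε hε1 hM0 hMK hK hεK hεexp hτ1 hτ2 hcτ (hsub t ht')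
  have hc : ∀ t ∈ Icc t₀ T, 0 < X t 2 := fun t ht' =>
    lt_of_lt_of_le (by positivity)
      (c_floor_after hX h0 hε hε1 hM0 hMK hK hεK hεexp hτ1 hτ2 hcτ hcτeq (hsub t ht'))
  have hr : ∀ t ∈ Icc t₀ T, (1 / 8 * ε) ^ 2 ≤ X t 1 ^ 2 + X t 2 ^ 2 := by
    intro t ht'
    have h1 := hb t ht'
    have h2 : 0 ≤ ε / 8 := by positivity
    nlinarith [sq_nonneg (X t 2)]
  have hbT : 0 ≤ X T 1 := by linarith [hb T (right_mem_Icc.mpr ht)]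
  have h := taoFamily_dose_le_quarter_turn hX h0 hε ht (by norm_num : (0 : ℝ) < 1 / 8) hc hr
    hbT hC
  have h64 : ((1 / 8 : ℝ) ^ 2)⁻¹ = 64 := by norm_num
  have h8 : ε ^ 2 * exp (-M) * (T - t₀) / (1 / 8) = 8 * ε ^ 2 * exp (-M) * (T - t₀) := by
    ring
  rw [h64, h8] at h
  exact h

/-- **THE DOSE LAW IN THE CERTIFIED REGIME** (packaged: the regime of Theorem 5.3 for the retuned
family, `K ≥ K₀ = 2·20⁴²·42! + 16`, `3000 log K ≤ M ≤ K¹⁰`, `0 < ε ≤ e^{-10M}/K¹⁰⁰`). There is a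
critical time `t_c`, `|t_c - √2| ≤ 24 log K/M`, `1 ≤ t_c ≤ 3/2`, `c(t_c) = ε²/K¹⁰`, after which
the clock floor `b ≥ ε/8` and the trigger floor `c ≥ ε²/K¹⁰` hold on `[t_c,2]`, and on every
sub-window `[t₀,T] ⊆ [t_c,2]` every primitive `C` of the trigger obeys
`(M - 64)(C(T) - C(t₀)) < επ/2 + 8ε²e^{-M}(T-t₀)`.
[cite: Tao2016AveragedNS, §5.5 Theorem 5.3, (5.5), (5.6), (bogo-2)] -/
theorem certified_dose {K M ε : ℝ} {X : ℝ → Fin 5 → ℝ}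
    (hK : 2 * 20 ^ 42 * (Nat.factorial 42 : ℝ) + 16 ≤ K) (hML : 3000 * Real.log K ≤ M)
    (hMK : M ≤ K ^ 10) (hε : 0 < ε) (hεle : ε ≤ exp (-(10 * M)) / K ^ 100)
    (h0 : X 0 = delayInit) (hX : ∀ t, HasDerivAt X (delayCircuitWith K M ε (X t)) t) :
    ∃ tc : ℝ, |tc - Real.sqrt 2| ≤ 24 * Real.log K / M ∧ 1 ≤ tc ∧ tc ≤ 3 / 2 ∧
      X tc 2 = ε ^ 2 / K ^ 10 ∧
      (∀ t ∈ Icc tc 2, ε / 8 ≤ X t 1 ∧ ε ^ 2 / K ^ 10 ≤ X t 2) ∧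
      ∀ t₀ T : ℝ, tc ≤ t₀ → t₀ ≤ T → T ≤ 2 → ∀ C : ℝ → ℝ,
        (∀ t ∈ Icc t₀ T, HasDerivAt C (X t 2) t) →
          (M - 64) * (C T - C t₀) < ε * π / 2 + 8 * ε ^ 2 * exp (-M) * (T - t₀) := by
  obtain ⟨hK16, hM0, hML48, hlog2, -, -, -, -, -⟩ := Thm53With.family_params hK hML
  obtain ⟨hε1, hεK, -, hεexp⟩ := Thm53With.eps_facts hK16 hM0 hMK hε hεle
  obtain ⟨τ, hτ0, hτ2, hcτ, hτeq⟩ := Thm53.exists_hitTime (Thm53With.continuous_traj hX 2)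
    (θ := ε ^ 2 / K ^ 10) (T := 2) two_pos (by rw [Thm53.init_c h0]; positivity)
  obtain ⟨hlo, hhi, hτ1, hτ32, hcτeq⟩ :=
    Thm53With.tc_window hX h0 hε hε1 hM0 hMK hK16 hML48 hεK hτ0 hτ2 hcτ hτeq
  refine ⟨τ, Thm53With.abs_sub_sqrt_two_le hτ1 (div_nonneg (by linarith) hM0.le)
      (div_le_div_of_nonneg_right (by linarith) hM0.le) hlo hhi, hτ1, hτ32, hcτeq, ?_, ?_⟩
  · intro t ht
    exact ⟨Thm53With.b_lower_after hX h0 hε hε1 hM0 hMK hK16 hεK hεexp hτ1 hτ2 hcτ ht,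
      c_floor_after hX h0 hε hε1 hM0 hMK hK16 hεK hεexp hτ1 hτ2 hcτ hcτeq ht⟩
  · intro t₀ T h₀ ht hT C hC
    exact dose_after_tc hX h0 hε hε1 hM0 hMK hK16 hεK hεexp hτ1 hτ2 hcτ hcτeq h₀ ht hT hC

/-- **THE TRIGGER'S WHOLE DOSE AFTER `t_c` IS BELOW `2ε/M`.** In the certified regime, on every
sub-window `[t₀,T] ⊆ [t_c,2]`: `C(T) - C(t₀) < 2ε/M` (from `certified_dose`, `π/2 < 1.575`,
`16εe^{-M} ≤ 16/K¹⁰⁰`, `M ≥ 3000 log K ≥ 6000`).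
[cite: Tao2016AveragedNS, §5.5 Theorem 5.3, (5.5)] -/
theorem certified_dose_small {K M ε : ℝ} {X : ℝ → Fin 5 → ℝ}
    (hK : 2 * 20 ^ 42 * (Nat.factorial 42 : ℝ) + 16 ≤ K) (hML : 3000 * Real.log K ≤ M)
    (hMK : M ≤ K ^ 10) (hε : 0 < ε) (hεle : ε ≤ exp (-(10 * M)) / K ^ 100)
    (h0 : X 0 = delayInit) (hX : ∀ t, HasDerivAt X (delayCircuitWith K M ε (X t)) t) :
    ∃ tc : ℝ, |tc - Real.sqrt 2| ≤ 24 * Real.log K / M ∧ X tc 2 = ε ^ 2 / K ^ 10 ∧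
      ∀ t₀ T : ℝ, tc ≤ t₀ → t₀ ≤ T → T ≤ 2 → ∀ C : ℝ → ℝ,
        (∀ t ∈ Icc t₀ T, HasDerivAt C (X t 2) t) → C T - C t₀ < 2 * ε / M := by
  obtain ⟨hK16, hM0, -, hlog2, -, -, -, -, -⟩ := Thm53With.family_params hK hML
  obtain ⟨hε1, -, hε100, -⟩ := Thm53With.eps_facts hK16 hM0 hMK hε hεle
  obtain ⟨tc, htc, htc1, -, hceq, -, hdose⟩ := certified_dose hK hML hMK hε hεle h0 hX
  refine ⟨tc, htc, hceq, fun t₀ T h₀ ht hT C hC => ?_⟩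
  have h := hdose t₀ T h₀ ht hT C hC
  have hM6000 : 6000 ≤ M := by linarith
  have hK0 : 0 < K := by linarith
  have hKpow : (16 : ℝ) ^ 100 ≤ K ^ 100 := by gcongr
  have hε16 : ε ≤ 1 / 16 ^ 100 :=
    le_trans hε100 (one_div_le_one_div_of_le (by positivity) hKpow)
  have hεtiny : 16 * ε ≤ 1 / 1000 := by
    have : (16 : ℝ) * (1 / 16 ^ 100) ≤ 1 / 1000 := by norm_num
    linarith
  have hexp : exp (-M) ≤ 1 := by rw [exp_le_one_iff]; linarith
  have hlen : T - t₀ ≤ 2 := by linarith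
  have hrem : 8 * ε ^ 2 * exp (-M) * (T - t₀) ≤ ε / 1000 := by
    have h1 : 8 * ε ^ 2 * exp (-M) * (T - t₀) ≤ 8 * ε ^ 2 * 1 * 2 := by
      have : 0 ≤ 8 * ε ^ 2 := by positivity
      have : 0 ≤ 8 * ε ^ 2 * exp (-M) := by positivity
      calc 8 * ε ^ 2 * exp (-M) * (T - t₀) ≤ 8 * ε ^ 2 * exp (-M) * 2 := by gcongr
        _ ≤ 8 * ε ^ 2 * 1 * 2 := by gcongr
    nlinarith
  have hpi := Real.pi_lt_d2
  have hup : (M - 64) * (C T - C t₀) < ε * 1576 / 1000 := by nlinarith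
  have hM64 : 0 < M - 64 := by linarith
  rw [lt_div_iff₀ hM0]
  nlinarith
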